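import Mathlib
import Literature.RingTheory.PowerSeries.LaurentSeriesConstants
import HarnessLib

/-!
# `LogPrimitiveNL` (stmt-KontsevichZagierPeriods-2836), line `ax-schanuel-germs`, stub `stub_structure` —
part B: calculus of the Taylor morphism

The Taylor morphism `T : (ℝ → ℝ) → ℝ⸨X⸩` of the line is only known through its registered
properties (stub `stub_taylorMorphism`: locality, additivity and multiplicativity on germs `C^∞`
near `0`, `T ∘ deriv = d/dX ∘ T`, constants, identity). This file derives, from those properties
taken as HYPOTHESES on an arbitrary `T`, the consequences the structure theorem uses: smoothness
bookkeeping for germs (`∃ U ∈ 𝓝 0, ContDiffOn ℝ ∞ f U`), `T` of negations, scalar multiples, finite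
sums, inverses and logarithmic derivatives. Elementary. [folklore]
-/

noncomputable section

open Set Filter
open scoped ContDiff Topology LaurentSeries RatFunc Polynomial

namespace Summit.KontsevichZagierPeriods.LiouvilleUnfolding.LogPrimitiveNL.AxSchanuelGerms

/-! ### Germs smooth near `0` -/

/-- A function smooth near `0` is smooth on an OPEN neighbourhood of `0`. [folklore] -/
theorem smoothNear_open {f : ℝ → ℝ} (hf : ∃ U ∈ 𝓝 (0 : ℝ), ContDiffOn ℝ ∞ f U) :
    ∃ U : Set ℝ, IsOpen U ∧ (0 : ℝ) ∈ U ∧ ContDiffOn ℝ ∞ f U := by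
  obtain ⟨U, hU, hf⟩ := hf
  obtain ⟨V, hVU, hVo, hV0⟩ := mem_nhds_iff.1 hU
  exact ⟨V, hVo, hV0, hf.mono hVU⟩

/-- Sums of germs smooth near `0` are smooth near `0`. [folklore] -/
theorem smoothNear_add {f g : ℝ → ℝ} (hf : ∃ U ∈ 𝓝 (0 : ℝ), ContDiffOn ℝ ∞ f U)
    (hg : ∃ U ∈ 𝓝 (0 : ℝ), ContDiffOn ℝ ∞ g U) : ∃ U ∈ 𝓝 (0 : ℝ), ContDiffOn ℝ ∞ (f + g) U := by
  obtain ⟨U, hU, hf⟩ := hf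
  obtain ⟨V, hV, hg⟩ := hg
  exact ⟨U ∩ V, inter_mem hU hV, (hf.mono inter_subset_left).add (hg.mono inter_subset_right)⟩

/-- Products of germs smooth near `0` are smooth near `0`. [folklore] -/
theorem smoothNear_mul {f g : ℝ → ℝ} (hf : ∃ U ∈ 𝓝 (0 : ℝ), ContDiffOn ℝ ∞ f U)
    (hg : ∃ U ∈ 𝓝 (0 : ℝ), ContDiffOn ℝ ∞ g U) : ∃ U ∈ 𝓝 (0 : ℝ), ContDiffOn ℝ ∞ (f * g) U := by
  obtain ⟨U, hU, hf⟩ := hf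
  obtain ⟨V, hV, hg⟩ := hg
  exact ⟨U ∩ V, inter_mem hU hV, (hf.mono inter_subset_left).mul (hg.mono inter_subset_right)⟩

/-- Constants are smooth near `0`. [folklore] -/
theorem smoothNear_const (c : ℝ) : ∃ U ∈ 𝓝 (0 : ℝ), ContDiffOn ℝ ∞ (fun _ : ℝ => c) U :=
  ⟨univ, univ_mem, contDiffOn_const⟩

/-- The identity is smooth near `0`. [folklore] -/
theorem smoothNear_id : ∃ U ∈ 𝓝 (0 : ℝ), ContDiffOn ℝ ∞ (fun t : ℝ => t) U :=
  ⟨univ, univ_mem, contDiffOn_id⟩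

/-- The derivative of a germ smooth near `0` is smooth near `0`. [folklore] -/
theorem smoothNear_deriv {f : ℝ → ℝ} (hf : ∃ U ∈ 𝓝 (0 : ℝ), ContDiffOn ℝ ∞ f U) :
    ∃ U ∈ 𝓝 (0 : ℝ), ContDiffOn ℝ ∞ (deriv f) U := by
  obtain ⟨U, hUo, hU0, hf⟩ := smoothNear_open hf
  exact ⟨U, hUo.mem_nhds hU0, hf.deriv_of_isOpen hUo (by simp)⟩

/-- The inverse of a germ smooth and non-vanishing near `0` is smooth near `0`. [folklore] -/
theorem smoothNear_inv {f : ℝ → ℝ} (hf : ∃ U ∈ 𝓝 (0 : ℝ), ContDiffOn ℝ ∞ f U)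
    (h0 : ∀ᶠ t in 𝓝 (0 : ℝ), f t ≠ 0) :
    ∃ U ∈ 𝓝 (0 : ℝ), ContDiffOn ℝ ∞ (fun t => (f t)⁻¹) U := by
  obtain ⟨U, hU, hf⟩ := hf
  refine ⟨U ∩ {t | f t ≠ 0}, inter_mem hU h0, ?_⟩
  exact (hf.mono inter_subset_left).inv fun t ht => ht.2

/-- The logarithm of a germ smooth and positive near `0` is smooth near `0`. [folklore] -/
theorem smoothNear_log {f : ℝ → ℝ} (hf : ∃ U ∈ 𝓝 (0 : ℝ), ContDiffOn ℝ ∞ f U)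
    (h0 : ∀ᶠ t in 𝓝 (0 : ℝ), 0 < f t) :
    ∃ U ∈ 𝓝 (0 : ℝ), ContDiffOn ℝ ∞ (fun t => Real.log (f t)) U := by
  obtain ⟨U, hU, hf⟩ := hf
  refine ⟨U ∩ {t | 0 < f t}, inter_mem hU h0, ?_⟩
  exact (hf.mono inter_subset_left).log fun t ht => ht.2.ne'

/-- Finite sums of germs smooth near `0` are smooth near `0`. [folklore] -/
theorem smoothNear_sum {ι : Type*} (s : Finset ι) {f : ι → ℝ → ℝ}
    (hf : ∀ i ∈ s, ∃ U ∈ 𝓝 (0 : ℝ), ContDiffOn ℝ ∞ (f i) U) :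
    ∃ U ∈ 𝓝 (0 : ℝ), ContDiffOn ℝ ∞ (fun t => ∑ i ∈ s, f i t) U := by
  classical
  induction s using Finset.induction_on with
  | empty => simpa using smoothNear_const 0
  | insert a s ha ih =>
    have h := smoothNear_add (hf a (Finset.mem_insert_self a s))
      (ih fun i hi => hf i (Finset.mem_insert_of_mem hi))
    have heq : (fun t => ∑ i ∈ insert a s, f i t) = f a + fun t => ∑ i ∈ s, f i t := by
      ext t
      simp [Finset.sum_insert ha]
    rw [heq]
    exact h

/-! ### Consequences of the Taylor-morphism axioms -/

section Transport

variable (T : (ℝ → ℝ) → ℝ⸨X⸩)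
  (hloc : ∀ f g : ℝ → ℝ, f =ᶠ[𝓝 0] g → T f = T g)
  (hT2 : ∀ f g : ℝ → ℝ, (∃ U ∈ 𝓝 (0 : ℝ), ContDiffOn ℝ ∞ f U) →
    (∃ U ∈ 𝓝 (0 : ℝ), ContDiffOn ℝ ∞ g U) → T (f + g) = T f + T g ∧ T (f * g) = T f * T g)
  (hder : ∀ f : ℝ → ℝ, (∃ U ∈ 𝓝 (0 : ℝ), ContDiffOn ℝ ∞ f U) →
    T (deriv f) = LaurentSeries.derivative ℝ (T f))
  (hC : ∀ c : ℝ, T (fun _ => c) = HahnSeries.C c)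

include hT2 in
/-- `T` is additive on smooth germs. [folklore] -/
theorem taylor_add {f g : ℝ → ℝ} (hf : ∃ U ∈ 𝓝 (0 : ℝ), ContDiffOn ℝ ∞ f U)
    (hg : ∃ U ∈ 𝓝 (0 : ℝ), ContDiffOn ℝ ∞ g U) : T (fun t => f t + g t) = T f + T g :=
  (hT2 f g hf hg).1

include hT2 in
/-- `T` is multiplicative on smooth germs. [folklore] -/
theorem taylor_mul {f g : ℝ → ℝ} (hf : ∃ U ∈ 𝓝 (0 : ℝ), ContDiffOn ℝ ∞ f U)
    (hg : ∃ U ∈ 𝓝 (0 : ℝ), ContDiffOn ℝ ∞ g U) : T (fun t => f t * g t) = T f * T g :=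
  (hT2 f g hf hg).2

include hT2 hC in
/-- `T` of a real multiple. [folklore] -/
theorem taylor_const_mul (c : ℝ) {f : ℝ → ℝ} (hf : ∃ U ∈ 𝓝 (0 : ℝ), ContDiffOn ℝ ∞ f U) :
    T (fun t => c * f t) = HahnSeries.C c * T f := by
  rw [← hC c]
  exact taylor_mul T hT2 (smoothNear_const c) hf

include hT2 hC in
/-- `T` of a negation. [folklore] -/
theorem taylor_neg {f : ℝ → ℝ} (hf : ∃ U ∈ 𝓝 (0 : ℝ), ContDiffOn ℝ ∞ f U) :
    T (fun t => -f t) = -T f := by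
  have h := taylor_const_mul T hT2 hC (-1) hf
  simp only [neg_mul, one_mul] at h
  rw [h, map_neg, map_one, neg_one_mul]

include hT2 hC in
/-- `T` of a finite sum of smooth germs. [folklore] -/
theorem taylor_sum {ι : Type*} (s : Finset ι) {f : ι → ℝ → ℝ}
    (hf : ∀ i ∈ s, ∃ U ∈ 𝓝 (0 : ℝ), ContDiffOn ℝ ∞ (f i) U) :
    T (fun t => ∑ i ∈ s, f i t) = ∑ i ∈ s, T (f i) := by
  classical
  induction s using Finset.induction_on with
  | empty => simpa using hC 0
  | insert a s ha ih =>
    have h := taylor_add T hT2 (hf a (Finset.mem_insert_self a s))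
      (smoothNear_sum s fun i hi => hf i (Finset.mem_insert_of_mem hi))
    rw [Finset.sum_insert ha, ← ih fun i hi => hf i (Finset.mem_insert_of_mem hi), ← h]
    congr 1
    ext t
    simp [Finset.sum_insert ha]

include hT2 hC in
/-- `T` of an integer (or real) linear combination of smooth germs. [folklore] -/
theorem taylor_linearCombination {ι : Type*} [Fintype ι] (c : ι → ℝ) {f : ι → ℝ → ℝ}
    (hf : ∀ i, ∃ U ∈ 𝓝 (0 : ℝ), ContDiffOn ℝ ∞ (f i) U) :
    T (fun t => ∑ i, c i * f i t) = ∑ i, HahnSeries.C (c i) * T (f i) := by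
  rw [show (fun t => ∑ i, c i * f i t) =
      (fun t => ∑ i ∈ Finset.univ, ((fun _ : ℝ => c i) * f i) t) from rfl,
    taylor_sum T hT2 hC Finset.univ fun i _ => smoothNear_mul (smoothNear_const (c i)) (hf i)]
  exact Finset.sum_congr rfl fun i _ => taylor_const_mul T hT2 hC (c i) (hf i)

include hloc hT2 hC in
/-- `T` of the inverse of a smooth germ non-vanishing near `0` is the inverse, and `T` of the germ is
a unit. [folklore] -/
theorem taylor_inv {f : ℝ → ℝ} (hf : ∃ U ∈ 𝓝 (0 : ℝ), ContDiffOn ℝ ∞ f U)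
    (h0 : ∀ᶠ t in 𝓝 (0 : ℝ), f t ≠ 0) : T f ≠ 0 ∧ T (fun t => (f t)⁻¹) = (T f)⁻¹ := by
  have hinv : ∃ U ∈ 𝓝 (0 : ℝ), ContDiffOn ℝ ∞ (fun t => (f t)⁻¹) U := smoothNear_inv hf h0
  have hprod : T (fun t => f t * (f t)⁻¹) = T f * T (fun t => (f t)⁻¹) := taylor_mul T hT2 hf hinv
  have hone : T (fun t => f t * (f t)⁻¹) = 1 := by
    rw [hloc _ (fun _ => (1 : ℝ)) (h0.mono fun t ht => by simp [ht]), hC, map_one]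
  rw [hone] at hprod
  have hne : T f ≠ 0 := fun h => by simp [h] at hprod
  exact ⟨hne, (eq_inv_of_mul_eq_one_right hprod.symm)⟩

include hloc hT2 hder hC in
/-- **Logarithmic derivatives transport.** For a smooth germ `w` positive near `0`, the Laurent
series `T (log ∘ w)` has `d/dX`-derivative `(T w)⁻¹ · d/dX (T w)`. [folklore] -/
theorem derivative_taylor_log {w : ℝ → ℝ} (hw : ∃ U ∈ 𝓝 (0 : ℝ), ContDiffOn ℝ ∞ w U)
    (hpos : ∀ᶠ t in 𝓝 (0 : ℝ), 0 < w t) :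
    LaurentSeries.derivative ℝ (T (fun t => Real.log (w t))) =
      (T w)⁻¹ * LaurentSeries.derivative ℝ (T w) := by
  have hlog : ∃ U ∈ 𝓝 (0 : ℝ), ContDiffOn ℝ ∞ (fun t => Real.log (w t)) U := smoothNear_log hw hpos
  have h0 : ∀ᶠ t in 𝓝 (0 : ℝ), w t ≠ 0 := hpos.mono fun t ht => ht.ne'
  obtain ⟨U, hUo, hU0, hwU⟩ := smoothNear_open hw
  -- `deriv (log ∘ w) = deriv w / w` near `0`
  have hev : deriv (fun t => Real.log (w t)) =ᶠ[𝓝 0] fun t => deriv w t * (w t)⁻¹ := by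
    filter_upwards [hUo.mem_nhds hU0, h0] with t ht ht0
    have hd : DifferentiableAt ℝ w t :=
      (hwU.differentiableOn (by simp)).differentiableAt (hUo.mem_nhds ht)
    rw [deriv.log hd ht0, div_eq_mul_inv]
  rw [← hder _ hlog, hloc _ _ hev,
    show (fun t => deriv w t * (w t)⁻¹) = (fun t => deriv w t * (fun s => (w s)⁻¹) t) from rfl,
    taylor_mul T hT2 (smoothNear_deriv hw) (smoothNear_inv hw h0),
    hder _ hw, (taylor_inv T hloc hT2 hC hw h0).2, mul_comm]

end Transport

/-! ### Polynomial identities transport to algebraicity over `ℝ(X)` -/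

section Algebraic

variable (T : (ℝ → ℝ) → ℝ⸨X⸩)
  (hloc : ∀ f g : ℝ → ℝ, f =ᶠ[𝓝 0] g → T f = T g)
  (hT2 : ∀ f g : ℝ → ℝ, (∃ U ∈ 𝓝 (0 : ℝ), ContDiffOn ℝ ∞ f U) →
    (∃ U ∈ 𝓝 (0 : ℝ), ContDiffOn ℝ ∞ g U) → T (f + g) = T f + T g ∧ T (f * g) = T f * T g)
  (hC : ∀ c : ℝ, T (fun _ => c) = HahnSeries.C c)
  (hX : T (fun t => t) = HahnSeries.single 1 1)

/-- Polynomial expressions in a smooth germ and the variable are smooth germs. [folklore] -/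
theorem smoothNear_mvPolynomial_eval {φ : ℝ → ℝ} (hφ : ∃ U ∈ 𝓝 (0 : ℝ), ContDiffOn ℝ ∞ φ U)
    (q : MvPolynomial (Fin 2) ℝ) :
    ∃ U ∈ 𝓝 (0 : ℝ), ContDiffOn ℝ ∞
      (fun t => MvPolynomial.eval (Fin.cons (φ t) fun _ => t : Fin 2 → ℝ) q) U := by
  induction q using MvPolynomial.induction_on with
  | C a => simpa using smoothNear_const a
  | add p q hp hq =>
    simp only [map_add]
    exact smoothNear_add hp hq
  | mul_X p i hp =>
    simp only [map_mul, MvPolynomial.eval_X]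
    refine Fin.cases ?_ (fun j => ?_) i
    · simp only [Fin.cons_zero]
      exact smoothNear_mul hp hφ
    · simp only [Fin.cons_succ]
      exact smoothNear_mul hp smoothNear_id

include hT2 hC hX in
/-- **`T` commutes with polynomial expressions**: `T (q(φ, t)) = q(T φ, X)`. [folklore] -/
theorem taylor_mvPolynomial_eval {φ : ℝ → ℝ} (hφ : ∃ U ∈ 𝓝 (0 : ℝ), ContDiffOn ℝ ∞ φ U)
    (q : MvPolynomial (Fin 2) ℝ) :
    T (fun t => MvPolynomial.eval (Fin.cons (φ t) fun _ => t : Fin 2 → ℝ) q) =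
      MvPolynomial.aeval (Fin.cons (T φ) fun _ => (HahnSeries.single 1 1 : ℝ⸨X⸩) : Fin 2 → ℝ⸨X⸩)
        q := by
  induction q using MvPolynomial.induction_on with
  | C a =>
    simp only [MvPolynomial.eval_C, MvPolynomial.aeval_C,
      Literature.RingTheory.PowerSeries.algebraMap_laurentSeries_apply]
    exact hC a
  | add p q hp hq =>
    simp only [map_add]
    rw [← hp, ← hq]
    exact taylor_add T hT2 (smoothNear_mvPolynomial_eval hφ p) (smoothNear_mvPolynomial_eval hφ q)
  | mul_X p i hp =>
    simp only [map_mul, MvPolynomial.eval_X, MvPolynomial.aeval_X]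
    refine Fin.cases ?_ (fun j => ?_) i
    · simp only [Fin.cons_zero]
      rw [← hp, show (fun t => MvPolynomial.eval (Fin.cons (φ t) fun _ => t : Fin 2 → ℝ) p * φ t) =
        fun t => (fun s => MvPolynomial.eval (Fin.cons (φ s) fun _ => s : Fin 2 → ℝ) p) t * φ t
        from rfl]
      exact taylor_mul T hT2 (smoothNear_mvPolynomial_eval hφ p) hφ
    · simp only [Fin.cons_succ]
      rw [← hp, ← hX, show (fun t => MvPolynomial.eval (Fin.cons (φ t) fun _ => t : Fin 2 → ℝ) p * t) =
        fun t => (fun s => MvPolynomial.eval (Fin.cons (φ s) fun _ => s : Fin 2 → ℝ) p) t *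
          (fun s : ℝ => s) t from rfl]
      exact taylor_mul T hT2 (smoothNear_mvPolynomial_eval hφ p) smoothNear_id

/-- The coefficient embedding `ℝ[t] ≅ MvPolynomial (Fin 1) ℝ → ℝ(X)` used to read a bivariate
polynomial as a univariate polynomial over `ℝ(X)`: it kills only `0`. [folklore] -/
theorem aeval_X_ratFunc_ne_zero {c : MvPolynomial (Fin 1) ℝ} (hc : c ≠ 0) :
    (algebraMap ℝ[X] (RatFunc ℝ))
      (MvPolynomial.aeval (fun _ : Fin 1 => (Polynomial.X : ℝ[X])) c) ≠ 0 := by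
  intro h
  rw [map_eq_zero_iff _ (IsFractionRing.injective ℝ[X] (RatFunc ℝ))] at h
  apply hc
  apply MvPolynomial.funext
  intro w
  have hw : Polynomial.aeval (w 0)
      ((MvPolynomial.aeval fun _ : Fin 1 => (Polynomial.X : ℝ[X])) c) = 0 := by
    rw [h, map_zero]
  rw [← AlgHom.comp_apply, MvPolynomial.comp_aeval] at hw
  simp only [Polynomial.aeval_X] at hw
  have hwc : (fun _ : Fin 1 => w 0) = w := funext fun i => by rw [Subsingleton.elim i 0]
  change MvPolynomial.eval (fun _ : Fin 1 => w 0) c = 0 at hw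
  rw [hwc] at hw
  rw [hw, map_zero]

include hloc hT2 hC hX in
/-- **A polynomial identity makes the Taylor series algebraic over `ℝ(X)`**: if the smooth germ `φ`
satisfies `q(φ t, t) = 0` near `0` for a non-zero real polynomial `q` in two variables, then `T φ`
is algebraic over `RatFunc ℝ` inside `ℝ⸨X⸩`. [folklore] -/
theorem taylor_isAlgebraic {φ : ℝ → ℝ} (hφ : ∃ U ∈ 𝓝 (0 : ℝ), ContDiffOn ℝ ∞ φ U)
    {q : MvPolynomial (Fin 2) ℝ} (hq : q ≠ 0)
    (hid : ∀ᶠ t in 𝓝 (0 : ℝ), MvPolynomial.eval (Fin.cons (φ t) fun _ => t : Fin 2 → ℝ) q = 0) :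
    IsAlgebraic (RatFunc ℝ) (T φ) := by
  -- the identity in `ℝ⸨X⸩`
  have h1 : MvPolynomial.aeval
      (Fin.cons (T φ) fun _ => (HahnSeries.single 1 1 : ℝ⸨X⸩) : Fin 2 → ℝ⸨X⸩) q = 0 := by
    rw [← taylor_mvPolynomial_eval T hT2 hC hX hφ q, hloc _ (fun _ => (0 : ℝ)) hid, hC, map_zero]
  -- `q` as a univariate polynomial over `ℝ(X)`
  let ρ : MvPolynomial (Fin 1) ℝ →+* RatFunc ℝ :=
    (algebraMap ℝ[X] (RatFunc ℝ)).comp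
      (MvPolynomial.aeval fun _ : Fin 1 => (Polynomial.X : ℝ[X])).toRingHom
  let Q : Polynomial (RatFunc ℝ) := (MvPolynomial.finSuccEquiv ℝ 1 q).map ρ
  have hQ0 : MvPolynomial.finSuccEquiv ℝ 1 q ≠ 0 :=
    (map_ne_zero_iff _ (MvPolynomial.finSuccEquiv ℝ 1).injective).2 hq
  have hQ : Q ≠ 0 := by
    obtain ⟨j, hj⟩ : ∃ j, (MvPolynomial.finSuccEquiv ℝ 1 q).coeff j ≠ 0 := by
      by_contra hall
      push Not at hall
      exact hQ0 (Polynomial.ext fun j => by simpa using hall j)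
    intro hQ
    have := congr_arg (fun P => Polynomial.coeff P j) hQ
    simp only [Q, Polynomial.coeff_map, Polynomial.coeff_zero] at this
    exact aeval_X_ratFunc_ne_zero hj this
  -- the two evaluations agree: check on generators
  set g : MvPolynomial (Fin 1) ℝ →+* ℝ⸨X⸩ := (algebraMap (RatFunc ℝ) ℝ⸨X⸩).comp ρ with hg
  have hgC : ∀ a : ℝ, g (MvPolynomial.C a) = HahnSeries.C a := by
    intro a
    simp only [hg, ρ, RingHom.coe_comp, Function.comp_apply, AlgHom.toRingHom_eq_coe,
      RingHom.coe_coe, MvPolynomial.aeval_C, Polynomial.algebraMap_apply, Algebra.algebraMap_self_apply]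
    rw [show algebraMap ℝ[X] (RatFunc ℝ) (Polynomial.C a) = ((Polynomial.C a : ℝ[X]) : RatFunc ℝ)
      from rfl, ← RatFunc.coe_coe, Polynomial.coe_C, HahnSeries.ofPowerSeries_C]
  have hgX : g (MvPolynomial.X 0) = HahnSeries.single 1 1 := by
    simp only [hg, ρ, RingHom.coe_comp, Function.comp_apply, AlgHom.toRingHom_eq_coe,
      RingHom.coe_coe, MvPolynomial.aeval_X]
    rw [show algebraMap ℝ[X] (RatFunc ℝ) Polynomial.X = ((Polynomial.X : ℝ[X]) : RatFunc ℝ)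
      from rfl, ← RatFunc.coe_coe, Polynomial.coe_X, HahnSeries.ofPowerSeries_X]
  have hhom : ∀ p : MvPolynomial (Fin 2) ℝ,
      Polynomial.eval₂ g (T φ) (MvPolynomial.finSuccEquiv ℝ 1 p) =
        MvPolynomial.aeval
          (Fin.cons (T φ) fun _ => (HahnSeries.single 1 1 : ℝ⸨X⸩) : Fin 2 → ℝ⸨X⸩) p := by
    intro p
    induction p using MvPolynomial.induction_on with
    | C a =>
      rw [MvPolynomial.finSuccEquiv_apply, MvPolynomial.eval₂Hom_C, RingHom.coe_comp,
        Function.comp_apply, Polynomial.eval₂_C, hgC, MvPolynomial.aeval_C,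
        Literature.RingTheory.PowerSeries.algebraMap_laurentSeries_apply]
    | add p q hp hq => rw [map_add, Polynomial.eval₂_add, hp, hq, map_add]
    | mul_X p i hp =>
      rw [map_mul, Polynomial.eval₂_mul, hp, map_mul, MvPolynomial.aeval_X]
      congr 1
      refine Fin.cases ?_ (fun j => ?_) i
      · rw [MvPolynomial.finSuccEquiv_X_zero, Polynomial.eval₂_X, Fin.cons_zero]
      · rw [Subsingleton.elim j 0, MvPolynomial.finSuccEquiv_X_succ, Polynomial.eval₂_C, hgX,
          Fin.cons_succ]
  have h2 : Polynomial.aeval (T φ) Q = 0 := by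
    rw [Polynomial.aeval_def, Polynomial.eval₂_map, ← hg, hhom, h1]
  exact ⟨Q, hQ, h2⟩

end Algebraic

/-- **Registered ∀-form** of `taylor_isAlgebraic` (helper of `stub_structure`, line
`ax-schanuel-germs`): for any map `T` with the locality, ring and normalisation properties of the
Taylor morphism, a non-trivial real polynomial identity `q(φ t, t) = 0` near `0` for a smooth germ
`φ` makes `T φ` algebraic over `ℝ(X)`. [folklore] -/
theorem structure_taylor_isAlgebraic : ∀ (T : (ℝ → ℝ) → ℝ⸨X⸩),
    (∀ f g : ℝ → ℝ, f =ᶠ[𝓝 0] g → T f = T g) →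
    (∀ f g : ℝ → ℝ, (∃ U ∈ 𝓝 (0 : ℝ), ContDiffOn ℝ ∞ f U) →
      (∃ U ∈ 𝓝 (0 : ℝ), ContDiffOn ℝ ∞ g U) → T (f + g) = T f + T g ∧ T (f * g) = T f * T g) →
    (∀ c : ℝ, T (fun _ => c) = HahnSeries.C c) → T (fun t => t) = HahnSeries.single 1 1 →
    ∀ (φ : ℝ → ℝ) (q : MvPolynomial (Fin 2) ℝ), (∃ U ∈ 𝓝 (0 : ℝ), ContDiffOn ℝ ∞ φ U) → q ≠ 0 →
    (∀ᶠ t in 𝓝 (0 : ℝ), MvPolynomial.eval (Fin.cons (φ t) fun _ => t : Fin 2 → ℝ) q = 0) →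
    IsAlgebraic (RatFunc ℝ) (T φ) :=
  fun T hloc hT2 hC hX _ _ hφ hq hid => taylor_isAlgebraic T hloc hT2 hC hX hφ hq hid

end Summit.KontsevichZagierPeriods.LiouvilleUnfolding.LogPrimitiveNL.AxSchanuelGerms

end
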